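import Summits.BirchSwinnertonDyer.BirchSwinnertonDyer.Theorems.AlignedTransportAtTwoBSDOfMainConjectureRankOneAtTwoSigmaSqTwoChart
import Summits.BirchSwinnertonDyer.BirchSwinnertonDyer.Theorems.AlignedTransportAtTwoBSDOfMainConjectureRankOneAtTwoSigmaSqTwoODEFamily
import Summits.BirchSwinnertonDyer.BirchSwinnertonDyer.Theorems.AlignedTransportAtTwoBSDOfMainConjectureRankOneAtTwoSigmaSqTwoCanonicalPointAdic
import Literature.NumberTheory.EllipticCurves.PadicSigmaSqTwoUniversalRing
import Literature.NumberTheory.EllipticCurves.PadicWeierstrassZetaProofs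
import HarnessLib

/-!
# Specialisation: an integral odd sigma solution of the UNIVERSAL `a₁`-chart curve over `K₂ = R̂₂[1/2]` gives the PRINT fact
# `mazurTate_sigmaSq_existsUnique_two` (the last step, S6-end, of the discharge plan for the PRINT stub `stub_sigmaSqTwo`)

Cell `bsd-f1-sign2`, WIDTH-5 attach seat `bsd-line-att-p3` g8 (`--supports stmt-BirchSwinnertonDyer-23008`; plan
`Cruxes/BSDOfMainConjectureRankOneAtTwo/SIGMASQ-AT-TWO-att-p3.md`, §7/S6). THEOREMS ONLY; route-independent. BSD is not proved by any of this,
and the PRINT fact is NOT discharged here: this file reduces it to ONE statement about the universal curve.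

**`mazurTate_sigmaSq_existsUnique_two_of_universal`.** Let `𝓔 = universalCurve = y² + xy = x³ + B₂x² + B₆` over `R̂₂`
(`Literature…PadicSigmaSqTwo.Universal`), `K₂ = completeRingQ`. IF there are `σ ∈ K₂⟦z⟧`, `c ∈ K₂` with `σ = z + ⋯` a normalised ODD formal
solution of the sigma equation of `𝓔_{K₂}` with constant `c` whose SQUARE has all coefficients in `R̂₂ = intSubring` (this is what the Dwork
step S6 is to deliver, for the fixed-point constant `c` of `…ConstantFixedPoint.lean`), THEN `mazurTate_sigmaSq_existsUnique_two` holds: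
for every chart curve `⟨1, b₂, 0, 0, b₆⟩/ℤ₂` with `b₆` a unit, `D(b₂, b₆) = b₆((1 + 4b₂)³ + 432b₆)` is a unit, `ρ = specialize b₂ b₆ : R̂₂ → ℤ₂`
maps `𝓔` to it (`universalCurve_map_specialize`), `ρ_K : K₂ → ℚ₂` over `ρ` exists (`exists_ringHom_completeRingQ_padic`), `σ^{ρ_K}` is a normalised
odd solution over `ℚ₂` (`isFormallyOdd_map_ringHom`, `satisfiesSigmaODE_map_ringHom`) with `‖[zⁿ](σ^{ρ_K})²‖ ≤ 1` (`norm_le_one_of_mem_intSubring`),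
so `((σ^{ρ_K})², ρ_K c)` is a Mazur–Tate sigma-squared pair (`isMazurTateSigmaSqPair_sq_of_norm_coeff_sq_le`), and
`mazurTate_sigmaSq_existsUnique_two_of_forall_chart` (S0, `…SigmaSqTwoChart.lean`) concludes. (Blakestad–Grant's Thm. 15 at `p = 2`, squared.)

## Sources
C. Blakestad, D. Grant, J. Number Theory 249 (2023), Thm. 15 (specialisation of the universal sigma function) [cite: BlakestadGrant2023, Thm. 15];
B. Mazur, J. Tate, Duke Math. J. 62 (1991), Thm. 3.1 [cite: MazurTate1991, Thm. 3.1].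
-/

noncomputable section

set_option linter.dupNamespace false
set_option autoImplicit false

open scoped Classical
open PowerSeries WeierstrassCurve Literature.NumberTheory.EllipticCurves
open Literature.NumberTheory.EllipticCurves.PadicSigmaSqTwo.Universal

namespace Summit.BirchSwinnertonDyer.BirchSwinnertonDyer.Theorems.AlignedTransportAtTwoSigmaSqTwo

/-- For a unit `b₆ ∈ ℤ₂`, `D(b₂, b₆) = b₆((1 + 4b₂)³ + 432b₆)` is a unit (the second factor is `≡ 1 (mod 2)`). [cite: BlakestadGrant2023, Thm. 15] -/
theorem isUnit_D_of_isUnit (b₂ b₆ : ℤ_[2]) (hb₆ : IsUnit b₆) : IsUnit (b₆ * ((1 + 4 * b₂) ^ 3 + 432 * b₆)) := by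
  haveI : IsAdicComplete (Ideal.span {(2 : ℤ_[2])}) ℤ_[2] := by
    have h := padicInt_isAdicComplete_span_p 2
    rwa [Nat.cast_ofNat] at h
  refine hb₆.mul (isUnit_of_sub_mem isUnit_one ?_)
  exact Ideal.mem_span_singleton'.mpr ⟨6 * b₂ + 24 * b₂ ^ 2 + 32 * b₂ ^ 3 + 216 * b₆, by ring⟩

/-- **The PRINT fact from an integral odd sigma solution of the universal chart curve** (Blakestad–Grant's Thm. 15 at `p = 2`, squared
currency): see the module docstring. [cite: BlakestadGrant2023, Thm. 15] [cite: MazurTate1991, Thm. 3.1] -/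
theorem mazurTate_sigmaSq_existsUnique_two_of_universal {σ : PowerSeries completeRingQ} {c : completeRingQ}
    (h0 : constantCoeff σ = 0) (h1 : coeff 1 σ = 1)
    (hodd : (universalCurve.map (algebraMap completeRing completeRingQ)).IsFormallyOdd σ)
    (hODE : (universalCurve.map (algebraMap completeRing completeRingQ)).SatisfiesSigmaODE σ c)
    (hint : ∀ n, coeff n (σ ^ 2) ∈ intSubring) :
    mazurTate_sigmaSq_existsUnique_two := by
  refine mazurTate_sigmaSq_existsUnique_two_of_forall_chart fun b₂ b₆ hb₆ => ?_
  haveI : IsAdicComplete (Ideal.span {((2 : ℕ) : ℤ_[2])}) ℤ_[2] := padicInt_isAdicComplete_span_p 2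
  have hD := isUnit_D_of_isUnit b₂ b₆ hb₆
  set ρ : completeRing →+* ℤ_[2] := specialize b₂ b₆ hD with hρdef
  have hρ : universalCurve.map ρ = ⟨1, b₂, 0, 0, b₆⟩ := universalCurve_map_specialize b₂ b₆ hD
  obtain ⟨ρK, hρK⟩ := exists_ringHom_completeRingQ_padic ρ
  have hcomp : ρK.comp (algebraMap completeRing completeRingQ) = (algebraMap ℤ_[2] ℚ_[2]).comp ρ :=
    RingHom.ext fun x => by rw [RingHom.comp_apply, RingHom.comp_apply, hρK x]; rfl
  set V : WeierstrassCurve ℚ_[2] := (⟨1, b₂, 0, 0, b₆⟩ : WeierstrassCurve ℤ_[2]).baseChange ℚ_[2] with hV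
  have hcurve : (universalCurve.map (algebraMap completeRing completeRingQ)).map ρK = V := by
    rw [map_map, hcomp, ← map_map, hρ, hV, WeierstrassCurve.baseChange]
  -- the specialised solution
  set σ' : ℚ_[2]⟦X⟧ := PowerSeries.map ρK σ with hσ'
  have h0' : constantCoeff σ' = 0 := by
    rw [hσ', ← coeff_zero_eq_constantCoeff_apply, coeff_map, coeff_zero_eq_constantCoeff_apply, h0, map_zero]
  have h1' : coeff 1 σ' = 1 := by rw [hσ', coeff_map, h1, map_one]
  have hodd' : V.IsFormallyOdd σ' := by rw [← hcurve]; exact isFormallyOdd_map_ringHom ρK hodd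
  have hODE' : V.SatisfiesSigmaODE σ' (ρK c) := by rw [← hcurve]; exact satisfiesSigmaODE_map_ringHom ρK h0 h1 hODE
  have hint' : ∀ n, ‖coeff n (σ' ^ 2)‖ ≤ 1 := fun n => by
    rw [hσ', ← map_pow, coeff_map]
    exact norm_le_one_of_mem_intSubring hρK (hint n)
  exact ⟨σ' ^ 2, ρK c, isMazurTateSigmaSqPair_sq_of_norm_coeff_sq_le h0' h1' hodd' hODE' hint'⟩

end Summit.BirchSwinnertonDyer.BirchSwinnertonDyer.Theorems.AlignedTransportAtTwoSigmaSqTwo
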